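import Literature.NumberTheory.Automorphic.ArchEndoscopicChartOrbitalContinuity   -- ★ p849873 (F0P3a-p09 (g5)): `uniformlyProper_endoTorus`, `continuousOn_chartOrbH_regS`
import Literature.MeasureTheory.Group.QuotientOrbitalIntegralProperSmooth          -- ★∕(G) (LH3-p01 (g3)): `contDiffOn_integral_descConj_of_uniformlyProper`
import Literature.NumberTheory.Rogawski1990.ArchSmoothAmbientLift                   -- ★ `ArchSmooth₂.exists_contDiff` (ambient smooth `Θ`)
import Literature.NumberTheory.Automorphic.ArchTorusOrbitalFubiniSmooth             -- ★ `coe_archPiEquivCM_symm_apply` (the matrix of `e⁻¹ u`)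
import Literature.NumberTheory.Rogawski1990.ArchBouazizStableFamily                 -- ★ p849717 (LH3-p01 (g3)): `stOrbFamH`, `stOrbFamH_of_mem_regS`; ★ `stableSum`, `archRH`, `flipSet`
import HarnessLib

/-!
# The chart orbital functionals `chartOrbH` of `H_∞` are `C^∞` on the regular set `RegS S` of every Cartan chart
# («(I₃-RegS-H)»: Harish-Chandra smoothness away from the walls; Rogawski 1990 §8.2–8.3, Shelstad 1979 §4, Bouaziz 1994 §3.2)

Topic `NumberTheory/Automorphic`; namespaces `Literature.NumberTheory.Automorphic.UnitaryGroup` (§1–§2),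
`Literature.NumberTheory.Automorphic.ArchCartan` (§3) and `Literature.NumberTheory.Rogawski1990` (§4).  THEOREMS ONLY.
Cell `pub/hodgecm-mathlib`, crux H413 (`stmt-HodgeConjecture-24833`), line LH3 (stub `stub_N9`, direct road), organ O-L3′ clause (I₃)
AWAY FROM THE WALLS; count-neutral.

THE MATHEMATICS.  `H_∞ = U(Φ₂)(L⁺ ⊗ ℝ) × U(Φ₁)(L⁺ ⊗ ℝ)`, `T_S = chartTorusH S` the Cartan of chart type `S` with chart `c ↦ endoTorus S c`
(split block `diag(e^{x+iθ}, e^{-x+iθ})` at `w ∈ S`, Cayley circle block at `w ∉ S`, circle entry in `U(Φ₁)`).  For a test function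
`fH ∈ C_c^∞(H_∞)` (★ `ArchSmooth₂`, read as `fH = Θ ∘ ι_∞` with `Θ` smooth on `M₃(L ⊗ ℝ)`, ★ `ArchSmooth₂.exists_contDiff`) the chart orbital
functional `chartOrbH νH S fH c = t_S(B_S) · ∫_{H_∞ ⧸ T_S} fH(y · endoTorus S c · y⁻¹) d(νH∕t_S)` is `C^∞` on the regular set `RegS S`:
(§1) the chart is smooth in matrix currency, `c ↦ ι_∞(endoTorus S c) ∈ M₃(L ⊗ ℝ)` (entrywise exponentials);
(§2) the integrand FACTORS SMOOTHLY through the `T_S`-invariant continuous datum `p(y) = Ad(ι_∞ y) ∘ π_S`, `π_S` a linear projection of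
`M₃(L ⊗ ℝ)` onto the commutant of `ι_∞(T_S)` — `fH(y · endoTorus S c · y⁻¹) = Θ(p(y)(ι_∞ endoTorus S c))` since `ι_∞(endoTorus S c)` commutes
with `ι_∞(T_S)` — so the generic ★ `contDiffOn_integral_descConj_of_uniformlyProper` (Hörmander's differentiation under the integral sign over
★ `uniformlyProper_endoTorus`) applies.  (§3–§4) Consequently the stable sum `stableSum S (chartOrbH νH S fH)`, the normaliser `archRH S`
and the NORMALISED STABLE ORBITAL FAMILY `stOrbFamH νH fH S` are `C^∞` on `RegS S` — the (I₃) clause of Bouaziz's space `𝓘(𝔥)`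
(★ `ArchBzSmoothBounded`) away from all walls.  HONEST LABEL: the extension ACROSS the split walls `x_w = 0` and the local boundedness
of the derivatives at the compact walls (the rest of (I₃)) are Harish-Chandra's deeper estimates and are NOT touched here; HC_CM is
proved only modulo the printed citations until rung 0 closes.

## References
* [Rogawski1990] J. D. Rogawski, *Automorphic Representations of Unitary Groups in Three Variables* (1990), §8.2 p. 122, §8.3 pp. 122–123.
* [Shelstad1979] D. Shelstad, *Characters and inner forms of a quasi-split group over ℝ*, Compositio Math. 39 (1979), §4 pp. 22–23.
* [Bouaziz1994IntegralesOrbitales] A. Bouaziz, *Intégrales orbitales sur les algèbres de Lie réductives*, Invent. Math. 115 (1994), §3.2 p. 580.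
* [Varadarajan1989] V. S. Varadarajan, *An Introduction to Harmonic Analysis on Semisimple Lie Groups* (1989), §2.4 Thm. 8.
* [HormanderALPDO1] L. Hörmander, *The Analysis of Linear Partial Differential Operators I* (1990), Thm. 1.1.9.
-/

set_option autoImplicit false

noncomputable section

open MeasureTheory Matrix NumberField NumberField.InfinitePlace NumberField.mixedEmbedding Set Function Topology Complex
open Literature.NumberTheory.Rogawski1990 Literature.NumberTheory.Automorphic.ArchCartan Literature.NumberTheory.Automorphic.UnitaryGroup
open scoped MatrixGroups ContDiff Classical
open scoped Matrix.Norms.Operator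

/-! ## §1 The chart is smooth in matrix currency -/

namespace Literature.NumberTheory.Automorphic.UnitaryGroup

section Chart

variable (L : Type) [Field L] [NumberField L] [IsCMField L] (S : Finset {w : InfinitePlace L // IsComplex w})

omit [IsCMField L] in
/-- **The entries of the `U(Φ₂)_w`-block of the chart are smooth in the coordinates** (`e^{±x_w + iθ_w}` at a split place, the Cayley
circle block `½(a ± b)`, `a = e^{i c_w0}`, `b = e^{i c_w2}`, at a compact place). [cite: Rogawski1990, §3.6 p. 31; §8.2 p. 122] -/
theorem contDiff_coe_endoBlock_apply (w : {w : InfinitePlace L // IsComplex w}) (i j : Fin 2) :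
    ContDiff ℝ ∞ fun c : {w : InfinitePlace L // IsComplex w} → Fin 3 → ℝ => ((endoBlock L S c w : GL (Fin 2) ℂ) : Matrix (Fin 2) (Fin 2) ℂ) i j := by
  have h0 : ContDiff ℝ ∞ fun c : {w : InfinitePlace L // IsComplex w} → Fin 3 → ℝ => ((c w 0 : ℝ) : ℂ) := ofRealCLM.contDiff.comp (contDiff_apply_apply ℝ ℝ w 0)
  have h2 : ContDiff ℝ ∞ fun c : {w : InfinitePlace L // IsComplex w} → Fin 3 → ℝ => ((c w 2 : ℝ) : ℂ) := ofRealCLM.contDiff.comp (contDiff_apply_apply ℝ ℝ w 2)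
  have he0 : ContDiff ℝ ∞ fun c : {w : InfinitePlace L // IsComplex w} → Fin 3 → ℝ => (Circle.exp (c w 0) : ℂ) := by
    have h : (fun c : {w : InfinitePlace L // IsComplex w} → Fin 3 → ℝ => (Circle.exp (c w 0) : ℂ)) = fun c => Complex.exp ((c w 0 : ℂ) * I) := funext fun c => Circle.coe_exp _
    rw [h]; exact Complex.contDiff_exp.comp (h0.mul contDiff_const)
  have he2 : ContDiff ℝ ∞ fun c : {w : InfinitePlace L // IsComplex w} → Fin 3 → ℝ => (Circle.exp (c w 2) : ℂ) := by
    have h : (fun c : {w : InfinitePlace L // IsComplex w} → Fin 3 → ℝ => (Circle.exp (c w 2) : ℂ)) = fun c => Complex.exp ((c w 2 : ℂ) * I) := funext fun c => Circle.coe_exp _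
    rw [h]; exact Complex.contDiff_exp.comp (h2.mul contDiff_const)
  by_cases hw : w ∈ S
  · have hf : (fun c : {w : InfinitePlace L // IsComplex w} → Fin 3 → ℝ => ((endoBlock L S c w : GL (Fin 2) ℂ) : Matrix (Fin 2) (Fin 2) ℂ) i j) =
        fun c => !![Complex.exp ((c w 0 : ℂ) + (c w 2 : ℂ) * I), 0; 0, Complex.exp (-(c w 0 : ℂ) + (c w 2 : ℂ) * I)] i j :=
      funext fun c => by rw [coe_endoBlock_of_mem L c hw]
    rw [hf]
    fin_cases i <;> fin_cases j
    · exact Complex.contDiff_exp.comp (h0.add (h2.mul contDiff_const))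
    · exact contDiff_const
    · exact contDiff_const
    · exact Complex.contDiff_exp.comp (h0.neg.add (h2.mul contDiff_const))
  · have hf : (fun c : {w : InfinitePlace L // IsComplex w} → Fin 3 → ℝ => ((endoBlock L S c w : GL (Fin 2) ℂ) : Matrix (Fin 2) (Fin 2) ℂ) i j) =
        fun c => !![((Circle.exp (c w 0) : ℂ) + Circle.exp (c w 2)) / 2, ((Circle.exp (c w 0) : ℂ) - Circle.exp (c w 2)) / 2;
          ((Circle.exp (c w 0) : ℂ) - Circle.exp (c w 2)) / 2, ((Circle.exp (c w 0) : ℂ) + Circle.exp (c w 2)) / 2] i j :=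
      funext fun c => by rw [coe_endoBlock_of_not_mem L c hw]
    rw [hf]
    fin_cases i <;> fin_cases j
    · exact (he0.add he2).div_const 2
    · exact (he0.sub he2).div_const 2
    · exact (he0.sub he2).div_const 2
    · exact (he0.add he2).div_const 2

omit [IsCMField L] in
/-- **The entry of the `U(Φ₁)_w`-block `e^{i c_w1}` is smooth in the coordinates.** [cite: Rogawski1990, §4.9 p. 54] -/
theorem contDiff_coe_endoCircle_apply (w : {w : InfinitePlace L // IsComplex w}) (i j : Fin 1) :
    ContDiff ℝ ∞ fun c : {w : InfinitePlace L // IsComplex w} → Fin 3 → ℝ => ((endoCircle L c w : GL (Fin 1) ℂ) : Matrix (Fin 1) (Fin 1) ℂ) i j := by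
  have hf : (fun c : {w : InfinitePlace L // IsComplex w} → Fin 3 → ℝ => ((endoCircle L c w : GL (Fin 1) ℂ) : Matrix (Fin 1) (Fin 1) ℂ) i j) =
      fun c => Complex.exp ((c w 1 : ℂ) * I) := by
    funext c
    rw [coe_endoCircle, Subsingleton.elim i j, Matrix.diagonal_apply_eq, Circle.coe_exp]
  rw [hf]
  exact Complex.contDiff_exp.comp ((ofRealCLM.contDiff.comp (contDiff_apply_apply ℝ ℝ w 1)).mul contDiff_const)

/-- **The matrix of `ι_∞(endoTorus S c)` entrywise**: the `endoPerm`-reindexed block sum of the complex coordinates of the two chart blocks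
(★ `coe_endoEmbArch`, `coe_endoGL`, `coe_archPiEquivCM_symm_apply`). [cite: Rogawski1990, §4.8 Case (a) p. 53; §8.2 p. 122] -/
theorem coe_endoEmbArch_endoTorus_apply (c : {w : InfinitePlace L // IsComplex w} → Fin 3 → ℝ) (i j : Fin 3) :
    ((((endoEmbArch L (endoTorus L S c)).val : GL (Fin 3) (mixedSpace L)) : Matrix (Fin 3) (Fin 3) (mixedSpace L)) i j) =
      Matrix.fromBlocks
        (Matrix.of fun i j : Fin 2 => ((0 : {w : InfinitePlace L // IsReal w} → ℝ),
          fun w : {w : InfinitePlace L // IsComplex w} => ((endoBlock L S c w : GL (Fin 2) ℂ) : Matrix (Fin 2) (Fin 2) ℂ) i j))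
        0 0
        (Matrix.of fun i j : Fin 1 => ((0 : {w : InfinitePlace L // IsReal w} → ℝ),
          fun w : {w : InfinitePlace L // IsComplex w} => ((endoCircle L c w : GL (Fin 1) ℂ) : Matrix (Fin 1) (Fin 1) ℂ) i j))
        (endoPerm.symm i) (endoPerm.symm j) := by
  have h1 : ((((endoTorus L S c).1 : ↥(arch (↥(maximalRealSubfield L)) L (IsCMField.complexConj L) 2 (Matrix.of fun i j : Fin 2 => if i.val + j.val + 1 = 2 then (1 : L) else 0))) : GL (Fin 2) (mixedSpace L)) : Matrix (Fin 2) (Fin 2) (mixedSpace L)) =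
      Matrix.of fun i j : Fin 2 => ((0 : {w : InfinitePlace L // IsReal w} → ℝ),
        fun w : {w : InfinitePlace L // IsComplex w} => ((endoBlock L S c w : GL (Fin 2) ℂ) : Matrix (Fin 2) (Fin 2) ℂ) i j) :=
    coe_archPiEquivCM_symm_apply L (N := 2) _ (endoBlock L S c)
  have h2 : ((((endoTorus L S c).2 : ↥(arch (↥(maximalRealSubfield L)) L (IsCMField.complexConj L) 1 (Matrix.of fun i j : Fin 1 => if i.val + j.val + 1 = 1 then (1 : L) else 0))) : GL (Fin 1) (mixedSpace L)) : Matrix (Fin 1) (Fin 1) (mixedSpace L)) =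
      Matrix.of fun i j : Fin 1 => ((0 : {w : InfinitePlace L // IsReal w} → ℝ),
        fun w : {w : InfinitePlace L // IsComplex w} => ((endoCircle L c w : GL (Fin 1) ℂ) : Matrix (Fin 1) (Fin 1) ℂ) i j) :=
    coe_archPiEquivCM_symm_apply L (N := 1) _ (endoCircle L c)
  rw [coe_endoEmbArch, coe_endoGL, Matrix.reindex_apply, Matrix.submatrix_apply, ← h1, ← h2]

/-- **THE CHART IS SMOOTH IN MATRIX CURRENCY**: `c ↦ ι_∞(endoTorus S c) ∈ M₃(L ⊗ ℝ)` is `ContDiff ℝ ∞` (entrywise through the linear `Matrix.of`).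
[cite: Rogawski1990, §8.2 p. 122] [cite: Shelstad1979, §4 p. 22] -/
theorem contDiff_coe_endoEmbArch_endoTorus :
    ContDiff ℝ ∞ fun c : {w : InfinitePlace L // IsComplex w} → Fin 3 → ℝ =>
      (((endoEmbArch L (endoTorus L S c)).val : GL (Fin 3) (mixedSpace L)) : Matrix (Fin 3) (Fin 3) (mixedSpace L)) := by
  let Λ : (Fin 3 → Fin 3 → mixedSpace L) →L[ℝ] Matrix (Fin 3) (Fin 3) (mixedSpace L) :=
    LinearMap.toContinuousLinearMap (Matrix.ofLinearEquiv ℝ : (Fin 3 → Fin 3 → mixedSpace L) ≃ₗ[ℝ] Matrix (Fin 3) (Fin 3) (mixedSpace L)).toLinearMap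
  have hΛ : ∀ f : Fin 3 → Fin 3 → mixedSpace L, Λ f = Matrix.of f := fun _ => rfl
  have hfun : (fun c : {w : InfinitePlace L // IsComplex w} → Fin 3 → ℝ =>
      (((endoEmbArch L (endoTorus L S c)).val : GL (Fin 3) (mixedSpace L)) : Matrix (Fin 3) (Fin 3) (mixedSpace L))) =
      fun c => Λ fun i j => (((endoEmbArch L (endoTorus L S c)).val : GL (Fin 3) (mixedSpace L)) : Matrix (Fin 3) (Fin 3) (mixedSpace L)) i j := by
    funext c; rw [hΛ]; rfl
  rw [hfun]
  refine Λ.contDiff.comp (contDiff_pi.2 fun i => contDiff_pi.2 fun j => ?_)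
  simp only [coe_endoEmbArch_endoTorus_apply]
  have hB : ∀ a b : Fin 2, ContDiff ℝ ∞ fun c : {w : InfinitePlace L // IsComplex w} → Fin 3 → ℝ => ((0 : {w : InfinitePlace L // IsReal w} → ℝ),
      fun w : {w : InfinitePlace L // IsComplex w} => ((endoBlock L S c w : GL (Fin 2) ℂ) : Matrix (Fin 2) (Fin 2) ℂ) a b) :=
    fun a b => contDiff_const.prodMk (contDiff_pi.2 fun w => contDiff_coe_endoBlock_apply L S w a b)
  have hC : ∀ a b : Fin 1, ContDiff ℝ ∞ fun c : {w : InfinitePlace L // IsComplex w} → Fin 3 → ℝ => ((0 : {w : InfinitePlace L // IsReal w} → ℝ),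
      fun w : {w : InfinitePlace L // IsComplex w} => ((endoCircle L c w : GL (Fin 1) ℂ) : Matrix (Fin 1) (Fin 1) ℂ) a b) :=
    fun a b => contDiff_const.prodMk (contDiff_pi.2 fun w => contDiff_coe_endoCircle_apply L w a b)
  rcases endoPerm.symm i with a | a <;> rcases endoPerm.symm j with b | b
  · exact hB a b
  · exact contDiff_const
  · exact contDiff_const
  · exact hC a b

end Chart

/-! ## §2 The head: `chartOrbH νH S fH` is `C^∞` on `RegS S` for `fH ∈ C_c^∞(H_∞)` -/

section Head

variable (L : Type) [Field L] [NumberField L] [IsCMField L] (S : Finset {w : InfinitePlace L // IsComplex w})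
  [MeasurableSpace (↥(arch (↥(maximalRealSubfield L)) L (IsCMField.complexConj L) 2 (Matrix.of fun i j : Fin 2 => if i.val + j.val + 1 = 2 then (1 : L) else 0)) ×
      ↥(arch (↥(maximalRealSubfield L)) L (IsCMField.complexConj L) 1 (Matrix.of fun i j : Fin 1 => if i.val + j.val + 1 = 1 then (1 : L) else 0)))]
  [BorelSpace (↥(arch (↥(maximalRealSubfield L)) L (IsCMField.complexConj L) 2 (Matrix.of fun i j : Fin 2 => if i.val + j.val + 1 = 2 then (1 : L) else 0)) ×
      ↥(arch (↥(maximalRealSubfield L)) L (IsCMField.complexConj L) 1 (Matrix.of fun i j : Fin 1 => if i.val + j.val + 1 = 1 then (1 : L) else 0)))]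
  (νH : Measure (↥(arch (↥(maximalRealSubfield L)) L (IsCMField.complexConj L) 2 (Matrix.of fun i j : Fin 2 => if i.val + j.val + 1 = 2 then (1 : L) else 0)) ×
      ↥(arch (↥(maximalRealSubfield L)) L (IsCMField.complexConj L) 1 (Matrix.of fun i j : Fin 1 => if i.val + j.val + 1 = 1 then (1 : L) else 0))))
  [IsFiniteMeasureOnCompacts νH] [νH.IsMulRightInvariant]

/-- **THE HEAD «(I₃-RegS-H)»: THE CHART ORBITAL FUNCTIONAL `c ↦ chartOrbH νH S fH c` IS `C^∞` ON `RegS S`** for every `fH ∈ C_c^∞(H_∞)`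
(★ `ArchSmooth₂`), every `νH` finite on compacts and right invariant, on EVERY Cartan chart `S` — Harish-Chandra's smoothness of orbital
integrals on the regular set, by differentiation under the quotient integral (★ `contDiffOn_integral_descConj_of_uniformlyProper` over
★ `uniformlyProper_endoTorus`, with the smooth factorisation `fH(y·γ(c)·y⁻¹) = Θ((Ad(ι_∞ y) ∘ π_S)(ι_∞ γ(c)))`, `π_S` a linear projection
onto the commutant of `ι_∞(T_S)`).  The `C^∞` upgrade of ★ `continuousOn_chartOrbH_regS`.
[cite: Rogawski1990, §8.3 pp. 122–123] [cite: Shelstad1979, §4 pp. 22–23] [cite: Varadarajan1989, §2.4 Thm. 8] [cite: HormanderALPDO1, Thm. 1.1.9] -/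
theorem contDiffOn_chartOrbH_regS {fH : ↥(arch (↥(maximalRealSubfield L)) L (IsCMField.complexConj L) 2 (Matrix.of fun i j : Fin 2 => if i.val + j.val + 1 = 2 then (1 : L) else 0)) ×
      ↥(arch (↥(maximalRealSubfield L)) L (IsCMField.complexConj L) 1 (Matrix.of fun i j : Fin 1 => if i.val + j.val + 1 = 1 then (1 : L) else 0)) → ℂ} (hfH : ArchSmooth₂ L fH) :
    ContDiffOn ℝ ∞ (chartOrbH L νH S fH) (RegS S) := by
  letI : MeasurableSpace ((↥(arch (↥(maximalRealSubfield L)) L (IsCMField.complexConj L) 2 (Matrix.of fun i j : Fin 2 => if i.val + j.val + 1 = 2 then (1 : L) else 0)) ×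
      ↥(arch (↥(maximalRealSubfield L)) L (IsCMField.complexConj L) 1 (Matrix.of fun i j : Fin 1 => if i.val + j.val + 1 = 1 then (1 : L) else 0))) ⧸ chartTorusH L S) := borel _
  haveI : BorelSpace ((↥(arch (↥(maximalRealSubfield L)) L (IsCMField.complexConj L) 2 (Matrix.of fun i j : Fin 2 => if i.val + j.val + 1 = 2 then (1 : L) else 0)) ×
      ↥(arch (↥(maximalRealSubfield L)) L (IsCMField.complexConj L) 1 (Matrix.of fun i j : Fin 1 => if i.val + j.val + 1 = 1 then (1 : L) else 0))) ⧸ chartTorusH L S) := ⟨rfl⟩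
  haveI : IsFiniteMeasureOnCompacts (chartQuotientMeasureH L νH S) := by
    unfold chartQuotientMeasureH
    infer_instance
  haveI : IsClosed (chartTorusH L S : Set (↥(arch (↥(maximalRealSubfield L)) L (IsCMField.complexConj L) 2 (Matrix.of fun i j : Fin 2 => if i.val + j.val + 1 = 2 then (1 : L) else 0)) ×
      ↥(arch (↥(maximalRealSubfield L)) L (IsCMField.complexConj L) 1 (Matrix.of fun i j : Fin 1 => if i.val + j.val + 1 = 1 then (1 : L) else 0)))) := isClosed_chartTorusH L S
  obtain ⟨Θ, hΘ, -, hΘf⟩ := hfH.exists_contDiff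
  -- the ambient reading `ι_∞ : H_∞ → M₃(L ⊗ ℝ)`
  let Ebar : ↥(arch (↥(maximalRealSubfield L)) L (IsCMField.complexConj L) 2 (Matrix.of fun i j : Fin 2 => if i.val + j.val + 1 = 2 then (1 : L) else 0)) ×
      ↥(arch (↥(maximalRealSubfield L)) L (IsCMField.complexConj L) 1 (Matrix.of fun i j : Fin 1 => if i.val + j.val + 1 = 1 then (1 : L) else 0)) → Matrix (Fin 3) (Fin 3) (mixedSpace L) :=
    fun k => (((endoEmbArch L k).val : GL (Fin 3) (mixedSpace L)) : Matrix (Fin 3) (Fin 3) (mixedSpace L))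
  have hEmul : ∀ x y, Ebar (x * y) = Ebar x * Ebar y := fun x y => by
    simp only [Ebar, map_mul, Subgroup.coe_mul, Units.val_mul]
  have hEone : Ebar 1 = 1 := by simp only [Ebar, map_one, OneMemClass.coe_one, Units.val_one]
  have hEinv : ∀ x, Ebar x * Ebar x⁻¹ = 1 := fun x => by rw [← hEmul, mul_inv_cancel, hEone]
  have hEcont : Continuous Ebar := Units.continuous_val.comp (continuous_subtype_val.comp (continuous_endoEmbArch L))
  -- the commutant of `ι_∞(T_S)` and a linear projection onto it
  let A : Submodule ℝ (Matrix (Fin 3) (Fin 3) (mixedSpace L)) :=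
    { carrier := {m | ∀ s ∈ chartTorusH L S, Ebar s * m = m * Ebar s}
      add_mem' := fun {a b} ha hb s hs => by rw [mul_add, add_mul, ha s hs, hb s hs]
      zero_mem' := fun s _ => by rw [mul_zero, zero_mul]
      smul_mem' := fun r m hm s hs => by
        show Ebar s * (r • m) = r • m * Ebar s
        rw [mul_smul_comm, smul_mul_assoc, hm s hs] }
  have hAmem : ∀ m, m ∈ A ↔ ∀ s ∈ chartTorusH L S, Ebar s * m = m * Ebar s := fun _ => Iff.rfl
  obtain ⟨B, hAB⟩ := A.exists_isCompl
  -- a basis of the commutant and its coordinate functionals (smooth: linear on a finite-dimensional space)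
  let b := Module.finBasis ℝ A
  let ℓ : Fin (Module.finrank ℝ A) → Matrix (Fin 3) (Fin 3) (mixedSpace L) →ₗ[ℝ] ℝ := fun k => (b.coord k) ∘ₗ (A.projectionOnto B hAB)
  have hℓ : ∀ k, ContDiff ℝ ∞ fun m : Matrix (Fin 3) (Fin 3) (mixedSpace L) => ℓ k m := fun k =>
    (LinearMap.toContinuousLinearMap (ℓ k)).contDiff
  have hrec : ∀ m ∈ A, ∑ k, ℓ k m • ((b k : A) : Matrix (Fin 3) (Fin 3) (mixedSpace L)) = m := by
    intro m hm
    have h1 : A.projectionOnto B hAB m = ⟨m, hm⟩ := Submodule.projectionOnto_apply_of_mem_left hAB hm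
    have h2 := congrArg (fun x : A => (x : Matrix (Fin 3) (Fin 3) (mixedSpace L))) (b.sum_repr (⟨m, hm⟩ : A))
    simp only [AddSubmonoidClass.coe_finsetSum, SetLike.val_smul] at h2
    have h3 : ∀ k, ℓ k m = b.repr (⟨m, hm⟩ : A) k := fun k => by
      show b.coord k (A.projectionOnto B hAB m) = _
      rw [h1, Module.Basis.coord_apply]
    simp only [h3]
    exact h2
  -- the `T_S`-invariant datum `p(y) = (Ad(ι_∞ y) b_k)_k`
  let p : (↥(arch (↥(maximalRealSubfield L)) L (IsCMField.complexConj L) 2 (Matrix.of fun i j : Fin 2 => if i.val + j.val + 1 = 2 then (1 : L) else 0)) ×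
      ↥(arch (↥(maximalRealSubfield L)) L (IsCMField.complexConj L) 1 (Matrix.of fun i j : Fin 1 => if i.val + j.val + 1 = 1 then (1 : L) else 0))) → Fin (Module.finrank ℝ A) → Matrix (Fin 3) (Fin 3) (mixedSpace L) :=
    fun h k => Ebar h * ((b k : A) : Matrix (Fin 3) (Fin 3) (mixedSpace L)) * Ebar h⁻¹
  have hp : Continuous p :=
    continuous_pi fun k => (hEcont.mul continuous_const).mul (hEcont.comp continuous_inv)
  have hpM : ∀ y, ∀ m ∈ chartTorusH L S, p (y * m) = p y := by
    intro y s hs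
    funext k
    have hc : Ebar s * ((b k : A) : Matrix (Fin 3) (Fin 3) (mixedSpace L)) = ((b k : A) : Matrix (Fin 3) (Fin 3) (mixedSpace L)) * Ebar s :=
      (hAmem _).1 (b k).2 s hs
    show Ebar (y * s) * ((b k : A) : Matrix (Fin 3) (Fin 3) (mixedSpace L)) * Ebar (y * s)⁻¹ =
      Ebar y * ((b k : A) : Matrix (Fin 3) (Fin 3) (mixedSpace L)) * Ebar y⁻¹
    rw [_root_.mul_inv_rev, hEmul, hEmul]
    calc Ebar y * Ebar s * ((b k : A) : Matrix (Fin 3) (Fin 3) (mixedSpace L)) * (Ebar s⁻¹ * Ebar y⁻¹)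
        = Ebar y * (Ebar s * ((b k : A) : Matrix (Fin 3) (Fin 3) (mixedSpace L)) * Ebar s⁻¹) * Ebar y⁻¹ := by simp only [mul_assoc]
      _ = Ebar y * ((b k : A) : Matrix (Fin 3) (Fin 3) (mixedSpace L)) * Ebar y⁻¹ := by rw [hc, mul_assoc (((b k : A) : Matrix (Fin 3) (Fin 3) (mixedSpace L))), hEinv, mul_one]
  -- the smooth factorisation `Ψ(m, c) = Θ(∑_k ℓ_k(ι_∞ endoTorus S c) • m_k)`
  let Ψ : (Fin (Module.finrank ℝ A) → Matrix (Fin 3) (Fin 3) (mixedSpace L)) × ({w : InfinitePlace L // IsComplex w} → Fin 3 → ℝ) → ℂ :=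
    fun q => Θ (∑ k, ℓ k ((((endoEmbArch L (endoTorus L S q.2)).val : GL (Fin 3) (mixedSpace L)) : Matrix (Fin 3) (Fin 3) (mixedSpace L))) • q.1 k)
  have hΨ : ContDiff ℝ ∞ Ψ := by
    refine hΘ.comp (ContDiff.sum fun k _ => ?_)
    have h1 : ContDiff ℝ ∞ fun q : (Fin (Module.finrank ℝ A) → Matrix (Fin 3) (Fin 3) (mixedSpace L)) × ({w : InfinitePlace L // IsComplex w} → Fin 3 → ℝ) =>
        ℓ k ((((endoEmbArch L (endoTorus L S q.2)).val : GL (Fin 3) (mixedSpace L)) : Matrix (Fin 3) (Fin 3) (mixedSpace L))) :=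
      (hℓ k).comp ((contDiff_coe_endoEmbArch_endoTorus L S).comp contDiff_snd)
    have h2 : ContDiff ℝ ∞ fun q : (Fin (Module.finrank ℝ A) → Matrix (Fin 3) (Fin 3) (mixedSpace L)) × ({w : InfinitePlace L // IsComplex w} → Fin 3 → ℝ) =>
        q.1 k := (contDiff_apply ℝ (Matrix (Fin 3) (Fin 3) (mixedSpace L)) k).comp contDiff_fst
    exact h1.smul h2
  have hfac : ∀ y x, fH (y * endoTorus L S x * y⁻¹) = Ψ (p y, x) := by
    intro y x
    have hmem : Ebar (endoTorus L S x) ∈ A := fun s hs => by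
      rw [← hEmul, ← hEmul, forall_mem_chartTorusH_comm L S x s hs]
    have hsum : ∑ k, ℓ k (Ebar (endoTorus L S x)) • p y k =
        Ebar y * (∑ k, ℓ k (Ebar (endoTorus L S x)) • ((b k : A) : Matrix (Fin 3) (Fin 3) (mixedSpace L))) * Ebar y⁻¹ := by
      rw [Finset.mul_sum, Finset.sum_mul]
      exact Finset.sum_congr rfl fun k _ => by rw [mul_smul_comm, smul_mul_assoc]
    show fH _ = Θ (∑ k, ℓ k (Ebar (endoTorus L S x)) • p y k)
    rw [hsum, hrec _ hmem, ← hEmul, ← hEmul]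
    exact hΘf _
  have h := Literature.MeasureTheory.Group.contDiffOn_integral_descConj_of_uniformlyProper (chartTorusH L S)
    (forall_mem_chartTorusH_comm L S) (isOpen_regS S) (uniformlyProper_endoTorus L S) (chartQuotientMeasureH L νH S)
    hfH.hasCompactSupport p hp hpM Ψ hΨ hfac
  have hEq : chartOrbH L νH S fH = fun c => ((chartHaarH L S (chartBoxImg L S)).toReal : ℂ) *
      ∫ q, Literature.MeasureTheory.Group.descConj (endoTorus L S c) (chartTorusH L S) (forall_mem_chartTorusH_comm L S c) fH q ∂(chartQuotientMeasureH L νH S) :=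
    funext fun c => chartOrbH_def L νH S fH c
  rw [hEq]
  exact contDiffOn_const.mul h

end Head

end Literature.NumberTheory.Automorphic.UnitaryGroup

/-! ## §3 Coordinate companions: `flipSet`, `stableSum`, `archRH` are smooth on `RegS S` -/

namespace Literature.NumberTheory.Automorphic.ArchCartan

section Coord

variable {W : Type*} [Fintype W] [DecidableEq W]

/-- `flipSet T` is smooth (a coordinate permutation). [cite: Shelstad1979, §4 p. 23] -/
theorem contDiff_flipSet (T : Finset W) : ContDiff ℝ ∞ (flipSet T : (W → Fin 3 → ℝ) → W → Fin 3 → ℝ) := by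
  refine contDiff_pi.2 fun w => ?_
  by_cases h : w ∈ T
  · simp only [flipSet, if_pos h]
    have h0 : ContDiff ℝ ∞ fun a : W → Fin 3 → ℝ => a w 0 := contDiff_apply_apply ℝ ℝ w 0
    have h1 : ContDiff ℝ ∞ fun a : W → Fin 3 → ℝ => a w 1 := contDiff_apply_apply ℝ ℝ w 1
    have h2 : ContDiff ℝ ∞ fun a : W → Fin 3 → ℝ => a w 2 := contDiff_apply_apply ℝ ℝ w 2
    refine contDiff_pi.2 fun j => ?_
    fin_cases j
    · simpa using h2
    · simpa using h1
    · simpa using h0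
  · simp only [flipSet, if_neg h]
    exact contDiff_apply ℝ (Fin 3 → ℝ) w

/-- **The stable sum of a family smooth on `RegS S` is smooth on `RegS S`** (the flips `flipSet T`, `T ⊆ Sᶜ`, preserve `RegS S`).
[cite: Shelstad1979, §4 p. 23] [cite: Rogawski1990, §4.1 (4.1.1) p. 39] -/
theorem contDiffOn_stableSum (S : Finset W) {Φ : (W → Fin 3 → ℝ) → ℂ} (hΦ : ContDiffOn ℝ ∞ Φ (RegS S)) :
    ContDiffOn ℝ ∞ (stableSum S Φ) (RegS S) := by
  unfold stableSum
  refine ContDiffOn.sum fun T hT => ?_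
  exact hΦ.comp (contDiff_flipSet T).contDiffOn fun c hc => (flipSet_mem_regS_iff S (not_mem_of_mem_powerset_sdiff hT) c).2 hc

/-- **Shelstad's normaliser `archRH S` is smooth on `RegS S`** (`|e^x − e^{−x}|` is smooth off `x = 0`; the circle factors are entire).
[cite: Shelstad1979, §4 p. 22] [cite: Bouaziz1994IntegralesOrbitales, §3.2 p. 580] -/
theorem contDiffOn_archRH_regS (S : Finset W) : ContDiffOn ℝ ∞ (archRH S) (RegS S) := by
  unfold archRH
  refine contDiffOn_prod fun w _ => ?_
  by_cases hw : w ∈ S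
  · simp only [if_pos hw]
    intro c hc
    have hx : c w 0 ≠ 0 := ((mem_regS_iff S c).1 hc).2 w hw
    have hne : Real.exp (c w 0) - Real.exp (-c w 0) ≠ 0 := by
      intro h0
      have h' : c w 0 = -c w 0 := Real.exp_injective (sub_eq_zero.1 h0)
      exact hx (by linarith)
    have hg : ContDiff ℝ ∞ fun c : W → Fin 3 → ℝ => Real.exp (c w 0) - Real.exp (-c w 0) :=
      (Real.contDiff_exp.comp (contDiff_apply_apply ℝ ℝ w 0)).sub (Real.contDiff_exp.comp (contDiff_apply_apply ℝ ℝ w 0).neg)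
    exact (ofRealCLM.contDiff.contDiffAt.comp c (hg.contDiffAt.abs hne)).contDiffWithinAt
  · simp only [if_neg hw]
    have he : ContDiff ℝ ∞ fun c : W → Fin 3 → ℝ => (Circle.exp (c w 2 - c w 0) : ℂ) := by
      have h : (fun c : W → Fin 3 → ℝ => (Circle.exp (c w 2 - c w 0) : ℂ)) = fun c => Complex.exp (((c w 2 - c w 0 : ℝ) : ℂ) * I) :=
        funext fun c => Circle.coe_exp _
      rw [h]
      exact Complex.contDiff_exp.comp
        ((ofRealCLM.contDiff.comp ((contDiff_apply_apply ℝ ℝ w 2).sub (contDiff_apply_apply ℝ ℝ w 0))).mul contDiff_const)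
    exact (contDiff_const.sub he).contDiffOn

end Coord

end Literature.NumberTheory.Automorphic.ArchCartan

/-! ## §4 The normalised stable orbital family is smooth on `RegS S` — clause (I₃) of `𝓘(𝔥)` away from the walls -/

namespace Literature.NumberTheory.Rogawski1990

section Family

variable (L : Type) [Field L] [NumberField L] [IsCMField L]
  [MeasurableSpace (↥(arch (↥(maximalRealSubfield L)) L (IsCMField.complexConj L) 2 (Matrix.of fun i j : Fin 2 => if i.val + j.val + 1 = 2 then (1 : L) else 0)) ×
      ↥(arch (↥(maximalRealSubfield L)) L (IsCMField.complexConj L) 1 (Matrix.of fun i j : Fin 1 => if i.val + j.val + 1 = 1 then (1 : L) else 0)))]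
  [BorelSpace (↥(arch (↥(maximalRealSubfield L)) L (IsCMField.complexConj L) 2 (Matrix.of fun i j : Fin 2 => if i.val + j.val + 1 = 2 then (1 : L) else 0)) ×
      ↥(arch (↥(maximalRealSubfield L)) L (IsCMField.complexConj L) 1 (Matrix.of fun i j : Fin 1 => if i.val + j.val + 1 = 1 then (1 : L) else 0)))]
  (νH : Measure (↥(arch (↥(maximalRealSubfield L)) L (IsCMField.complexConj L) 2 (Matrix.of fun i j : Fin 2 => if i.val + j.val + 1 = 2 then (1 : L) else 0)) ×
      ↥(arch (↥(maximalRealSubfield L)) L (IsCMField.complexConj L) 1 (Matrix.of fun i j : Fin 1 => if i.val + j.val + 1 = 1 then (1 : L) else 0))))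
  [IsFiniteMeasureOnCompacts νH] [νH.IsMulRightInvariant]

/-- **The stable sum `Σ_T chartOrbH νH S fH (flipSet T c)` is `C^∞` on `RegS S`** for `fH ∈ C_c^∞(H_∞)`. [cite: Shelstad1979, §4 pp. 22–23]
[cite: Rogawski1990, §8.3 p. 122] -/
theorem contDiffOn_stableSum_chartOrbH_regS {fH : ↥(arch (↥(maximalRealSubfield L)) L (IsCMField.complexConj L) 2 (Matrix.of fun i j : Fin 2 => if i.val + j.val + 1 = 2 then (1 : L) else 0)) ×
      ↥(arch (↥(maximalRealSubfield L)) L (IsCMField.complexConj L) 1 (Matrix.of fun i j : Fin 1 => if i.val + j.val + 1 = 1 then (1 : L) else 0)) → ℂ} (hfH : ArchSmooth₂ L fH) (S : Finset {w : InfinitePlace L // IsComplex w}) :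
    ContDiffOn ℝ ∞ (stableSum S (chartOrbH L νH S fH)) (RegS S) :=
  contDiffOn_stableSum S (contDiffOn_chartOrbH_regS L S νH hfH)

/-- **(I₃) AWAY FROM THE WALLS FOR THE STABLE ORBITAL FAMILY**: `stOrbFamH νH fH S = R_S · Σ_T chartOrbH ∘ flipSet T` is `C^∞` on the regular
set `RegS S` of every chart `S`, for every `fH ∈ C_c^∞(H_∞)` (★ `ArchSmooth₂`) — the regular-set part of the clause `ArchBzSmoothBounded` of
Bouaziz's space for the family ★ `stOrbFamH`. [cite: Bouaziz1994IntegralesOrbitales, §3.2 p. 580] [cite: Shelstad1979, §4 pp. 22–23]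
[cite: Rogawski1990, §8.3 pp. 122–123] [cite: Varadarajan1989, §2.4 Thm. 8] -/
theorem contDiffOn_stOrbFamH_regS {fH : ↥(arch (↥(maximalRealSubfield L)) L (IsCMField.complexConj L) 2 (Matrix.of fun i j : Fin 2 => if i.val + j.val + 1 = 2 then (1 : L) else 0)) ×
      ↥(arch (↥(maximalRealSubfield L)) L (IsCMField.complexConj L) 1 (Matrix.of fun i j : Fin 1 => if i.val + j.val + 1 = 1 then (1 : L) else 0)) → ℂ} (hfH : ArchSmooth₂ L fH) (S : Finset {w : InfinitePlace L // IsComplex w}) :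
    ContDiffOn ℝ ∞ (stOrbFamH L νH fH S) (RegS S) := by
  have h : ContDiffOn ℝ ∞ (fun c => archRH S c * stableSum S (chartOrbH L νH S fH) c) (RegS S) :=
    (contDiffOn_archRH_regS S).mul (contDiffOn_stableSum_chartOrbH_regS L νH hfH S)
  refine h.congr fun c hc => ?_
  rw [stOrbFamH_of_mem_regS L νH fH S hc, stableSum_def]

end Family

end Literature.NumberTheory.Rogawski1990

end
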